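import Summits.ResolutionOfSingularities.ResolutionOfSingularities.Theorems.EquisingularLiftEquisingularLiftNatHostedPointStepSeam
import Summits.ResolutionOfSingularities.ResolutionOfSingularities.Theorems.EquisingularLiftEquisingularLiftNatLetterTransport
import Summits.ResolutionOfSingularities.ResolutionOfSingularities.Theorems.EquisingularLiftEquisingularLiftNatMemberSLStepRegular
import Summits.ResolutionOfSingularities.ResolutionOfSingularities.Theorems.EquisingularLiftEquisingularLiftNatHostedEngineInit
import HarnessLib

/-!
# [OURS · L1 W4.5(b) · EL♮(3) · WIDTH TABLE D5 «IMMATURE HOST», supplier row HPT⁶] THE LETTERED POINT-STEP SUPPLIER OF THE K5⁶ ENGINE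
# `TCPlus.hpt6_supplier k n : <HPT⁶ of ✓ target_elnat_of_letteredPrefixResolution (p669625), verbatim>` — unconditional

res-L1-w45b-stub-2 g16 (desk R54: «HPT⁶ assembly = stub-2»).  OURS; NOT a statement of any manuscript ([Hironaka2017] is a candidate under adjudication,
nothing of it is asserted); AI-written, weaker than expert review.  No `sorry`; standard axioms; DEF-FREE.  `--supports stmt-ResolutionOfSingularities-20148 --as helper`.

WHAT.  The HPT⁶ binder of the engine (any `n`): at a `Ch`-stage with model square `j : F₁ ⟶ X'`, listed letters `Ls` (✓ `TCPlus.LetterDatum` each) and the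
tag block `Kp`, a LETTERED POINT STEP at a closed non-regular point `x` of `T̃₁` (regular on `F₁`) — at most ONE listed letter through `x` (`Lt = some L`,
`L̃` regular at `x`), every other listed letter and the tag's three letters AWAY — and its blow-up `υ = Bl_x` are matched by a `Ch`-stage `X₁ = Bl_s X'`
(`s` a Hensel section through `j x`, NESTED in the through-letter's model when there is one) with a model square for `F₂`, `St T₁` irreducible, `F₂`
integral, a `LetterDatum` for the strict transform of EVERY listed letter, one for the NEW exceptional letter `υ⁻¹{x}`, and the tag block transported.
PROOF (pure composition).  The point step WITH the through-letter (or the empty letter ✓ `TCPlus.letterDatum_empty` when `Lt = none`) is res-L1-w45b-stub-4's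
✓ `TCPlus.hpt_seam`; every other letter is AWAY and keeps its model `𝓛·𝒪_{X₁}` — res-type-027's ✓ `TCPlus.letterDatum_transport_away`, re-run here with
the MODEL KEPT EXPLICIT (`letterClauses_transport_away`) so that the tag's incidence `𝓚 ≤ 𝓐 ⊔ 𝓒` is transported by `comap_mono`/`comap_sup`; the new
exceptional letter is ✓ `TCPlus.letterDatum_newPlane` (res-L1-w45b-stub-2 g13 `exists_planeModel`); `closure υ⁻¹(closure L ∖ {x}) = closure υ⁻¹(L ∖ {x})`
is ✓ `closure_preimage_closure_diff_singleton`. [folklore; pure composition of the cited tree theorems]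
-/

set_option linter.dupNamespace false -- mandated namespace `Summit.<Summit>.<Problem>` of this single-conjunct summit
set_option linter.overlappingInstances false -- signatures carry `[IsDomain O] [IsDiscreteValuationRing O]`

noncomputable section

open CategoryTheory CategoryTheory.Limits AlgebraicGeometry TopologicalSpace Topology IsLocalRing
open Literature.AlgebraicGeometry.Resolution
open AlgebraicGeometry.Scheme.IdealSheafData
open Summit.ResolutionOfSingularities.ResolutionOfSingularities.Theses.EquisingularLift.Split
open Summit.ResolutionOfSingularities.ResolutionOfSingularities.Cruxes.EquisingularLift.StrataSplit

namespace Summit.ResolutionOfSingularities.ResolutionOfSingularities.Cruxes.EquisingularLiftNat.Sections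

/-- **AWAY with the model kept** (res-type-027's ✓ `TCPlus.letterDatum_transport_away`, explicit-model form, letter not assumed closed): at a section step
(`τ = Bl_{ker s}`, `υ = Bl_{pt}`, `j₂ ≫ τ = υ ≫ jG`, every ideal sheaf missing `jG pt` misses `supp (ker s)`), a model `𝓛` of a letter `L` with
`pt ∉ closure L` keeps its five clauses as `𝓛·𝒪_{X₂}` for `closure υ⁻¹(L ∖ {pt})`. [cite: GortzWedhorn2020, Prop. 13.91] [cite: StacksProject, Tag 033B]
[OURS · L1 W4.5b · HPT⁶ tool] -/
theorem TCPlus.letterClauses_transport_away (O : Type) [CommRing O] (P : Scheme.{0}) (q : P ⟶ Spec (.of O)) (Y : Set P)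
    {X X₂ G G₂ : Scheme.{0}} {σ : X ⟶ P} {jG : G ⟶ X} [IsLocallyNoetherian G] [IsLocallyNoetherian X]
    {τ : X₂ ⟶ X} {C : X.IdealSheafData} (hτ : IsBlowup τ C)
    {pt : G} (hpt : IsClosed ({pt} : Set G)) {υ₁ : G₂ ⟶ G} (hυ₁ : IsBlowup υ₁ (vanishingIdeal ⟨{pt}, hpt⟩))
    {j₂ : G₂ ⟶ X₂} (hcomm : j₂ ≫ τ = υ₁ ≫ jG)
    (hdisj : ∀ I : X.IdealSheafData, jG pt ∉ (I.support : Set X) → Disjoint (I.support : Set X) (C.support : Set X))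
    {L : Set G} (𝓛 : X.IdealSheafData)
    (hl1 : 𝓛.comap jG = vanishingIdeal (⟨closure L, isClosed_closure⟩ : Closeds G)) (hl2 : ∀ z : X, (stalkIdeal 𝓛 z).IsPrincipal)
    (hl3 : Scheme.IsRegular 𝓛.subscheme) (hl4 : σ '' (𝓛.support : Set X) ⊆ {p : P | ¬ IsGenericPoint p Y}) (hl5 : Flat (𝓛.subschemeι ≫ σ ≫ q))
    (hptL : pt ∉ closure L) :
    (𝓛.comap τ).comap j₂ = vanishingIdeal (⟨closure (closure (υ₁ ⁻¹' (L \ {pt}))), isClosed_closure⟩ : Closeds G₂) ∧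
      (∀ z : X₂, (stalkIdeal (𝓛.comap τ) z).IsPrincipal) ∧ Scheme.IsRegular (𝓛.comap τ).subscheme ∧
      (τ ≫ σ) '' ((𝓛.comap τ).support : Set X₂) ⊆ {p : P | ¬ IsGenericPoint p Y} ∧ Flat ((𝓛.comap τ).subschemeι ≫ (τ ≫ σ) ≫ q) := by
  -- the model misses the centre: its trace misses `pt`
  have hptsupp : jG pt ∉ (𝓛.support : Set X) := by
    intro hmem
    have h1 : pt ∈ ((𝓛.comap jG).support : Set G) := by rw [support_comap]; exact hmem
    rw [hl1, Scheme.IdealSheafData.coe_support_vanishingIdeal] at h1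
    exact hptL h1
  have hd : Disjoint (𝓛.support : Set X) (C.support : Set X) := hdisj 𝓛 hptsupp
  obtain ⟨e, he⟩ := exists_iso_subscheme_comap_of_disjoint hτ 𝓛 hd
  -- downstairs: `closure υ₁⁻¹(L ∖ {pt}) = υ₁⁻¹ (closure L)`
  have hDL : Disjoint ({pt} : Set G) (closure L) := Set.disjoint_singleton_left.mpr hptL
  have hcl : closure (υ₁ ⁻¹' (L \ {pt})) = υ₁ ⁻¹' closure L := by
    rw [← closure_preimage_closure_diff_singleton hpt hυ₁ L, sdiff_eq_left.mpr hDL.symm]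
    exact (isClosed_closure.preimage υ₁.continuous).closure_eq
  refine ⟨?_, fun z => isPrincipal_stalkIdeal_comap τ 𝓛 z (hl2 (τ z)), isRegular_subscheme_comap_of_disjoint hτ 𝓛 hd hl3, ?_, ?_⟩
  · -- (l-i) the trace: pull the reduced ideal of `closure L` back along `υ₁` (disjoint from the centre `{pt}`)
    have hdisj' : Disjoint ((⟨closure L, isClosed_closure⟩ : Closeds G) : Set G)
        (((vanishingIdeal ⟨{pt}, hpt⟩ : G.IdealSheafData)).support : Set G) := by
      rw [Scheme.IdealSheafData.coe_support_vanishingIdeal]; exact hDL.symm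
    rw [← Scheme.IdealSheafData.comap_comp, hcomm, Scheme.IdealSheafData.comap_comp, hl1, hυ₁.comap_vanishingIdeal_of_disjoint _ hdisj']
    congr 1
    refine Closeds.ext ?_
    change υ₁ ⁻¹' closure L = closure (closure (υ₁ ⁻¹' (L \ {pt})))
    rw [closure_closure, hcl]
  · -- (l-iv) off the generic point of `Y`
    rintro _ ⟨z, hz, rfl⟩
    have hz' : τ z ∈ (𝓛.support : Set X) := by rw [support_comap] at hz; exact hz
    rw [Scheme.Hom.comp_apply]
    exact hl4 ⟨τ z, hz', rfl⟩
  · -- (l-v) flat over `O` through the iso `V(𝓛·𝒪_{X₂}) ≅ V(𝓛)`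
    have hfac : (𝓛.comap τ).subschemeι ≫ (τ ≫ σ) ≫ q = e.hom ≫ (𝓛.subschemeι ≫ σ ≫ q) := by
      rw [← Category.assoc e.hom, he, Category.assoc, Category.assoc]
    rw [hfac]
    haveI := hl5
    infer_instance

/-- **HPT⁶: the lettered point-step supplier of the K5⁶ engine** — the conclusion is the engine's HPT⁶ hypothesis VERBATIM (see the module docstring).
[folklore; pure composition] [OURS · L1 W4.5b · WIDTH TABLE D5, supplier row HPT⁶] -/
theorem TCPlus.hpt6_supplier (k : Type) [Field k] (n : ℕ) :
    ∀ (O : Type) [CommRing O] [IsDomain O] [IsDiscreteValuationRing O] [IsAdicComplete (IsLocalRing.maximalIdeal O) O]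
        [IsAlgClosed (IsLocalRing.ResidueField O)] (θ : O →+* k), Function.Surjective θ →
      ∀ (P : AlgebraicGeometry.Scheme.{0}) (q : P ⟶ AlgebraicGeometry.Spec (.of O)) (Y : Set P) (Ch : ∀ X' : AlgebraicGeometry.Scheme.{0}, (X' ⟶ P) → Set X' → Prop),
        (∀ (X' X'' : AlgebraicGeometry.Scheme.{0}) (σ' : X' ⟶ P) (S' : Set X') (C : X'.IdealSheafData) (τ : X'' ⟶ X'),
          Ch X' σ' S' → Literature.AlgebraicGeometry.Resolution.IsBlowup τ C →
          Literature.AlgebraicGeometry.Resolution.Scheme.IsRegular C.subscheme → AlgebraicGeometry.Flat (C.subschemeι ≫ σ' ≫ q) →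
          σ' '' (C.support : Set X') ⊆ {y | ¬ IsGenericPoint y Y} → (C.support : Set X') ∩ (σ' ≫ q) ⁻¹' {IsLocalRing.closedPoint O} ⊆ S' →
          Ch X'' (τ ≫ σ') (closure (τ ⁻¹' (S' \ (C.support : Set X'))))) → (∀ (X' : AlgebraicGeometry.Scheme.{0}) (σ' : X' ⟶ P) (S' : Set X'), Ch X' σ' S' →
          Summit.ResolutionOfSingularities.ResolutionOfSingularities.Theses.EquisingularLift.Split.Chain P Y X' σ' S') →
        Y ⊆ q ⁻¹' {IsLocalRing.closedPoint O} → IsIrreducible Y → IsClosed Y →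
        AlgebraicGeometry.IsIntegral P → IsLocallyNoetherian P → Literature.AlgebraicGeometry.Resolution.Scheme.IsRegular P →
        AlgebraicGeometry.IsProper q → AlgebraicGeometry.SmoothOfRelativeDimension n q →
      -- the stage and its model
      ∀ (X' : AlgebraicGeometry.Scheme.{0}) (σ' : X' ⟶ P) (S' : Set X'), Ch X' σ' S' → AlgebraicGeometry.IsIntegral X' →
        IsLocallyNoetherian X' → Literature.AlgebraicGeometry.Resolution.Scheme.IsRegular X' → AlgebraicGeometry.IsDominant (σ' ≫ q) →
      ∀ (F₁ : AlgebraicGeometry.Scheme.{0}), AlgebraicGeometry.IsIntegral F₁ → ∀ (j : F₁ ⟶ X') (t : F₁ ⟶ AlgebraicGeometry.Spec (.of k)),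
        IsPullback j t (σ' ≫ q) (AlgebraicGeometry.Spec.map (CommRingCat.ofHom θ)) → ∀ (T₁ : Set F₁), IsClosed T₁ → IsIrreducible T₁ → j '' T₁ = S' →
      ∀ (Ls : List (Set F₁)) (Kp : Option (Set F₁ × Set F₁ × Set F₁)), (∀ L ∈ Ls, TCPlus.LetterDatum O P q Y F₁ X' σ' j L) →
        (∀ K A C : Set F₁, Kp = some (K, A, C) → (∃ (𝓚 𝓐 𝓒 : X'.IdealSheafData), (𝓚.comap j = AlgebraicGeometry.Scheme.IdealSheafData.vanishingIdeal (⟨closure K, isClosed_closure⟩ : TopologicalSpace.Closeds F₁) ∧ (∀ z : X', (Literature.AlgebraicGeometry.Resolution.stalkIdeal 𝓚 z).IsPrincipal) ∧ Literature.AlgebraicGeometry.Resolution.Scheme.IsRegular 𝓚.subscheme ∧ σ' '' (𝓚.support : Set X') ⊆ {y : ↥P | ¬ IsGenericPoint y Y} ∧ AlgebraicGeometry.Flat (𝓚.subschemeι ≫ σ' ≫ q)) ∧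
            (𝓐.comap j = AlgebraicGeometry.Scheme.IdealSheafData.vanishingIdeal (⟨closure A, isClosed_closure⟩ : TopologicalSpace.Closeds F₁) ∧ (∀ z : X', (Literature.AlgebraicGeometry.Resolution.stalkIdeal 𝓐 z).IsPrincipal) ∧ Literature.AlgebraicGeometry.Resolution.Scheme.IsRegular 𝓐.subscheme ∧ σ' '' (𝓐.support : Set X') ⊆ {y : ↥P | ¬ IsGenericPoint y Y} ∧ AlgebraicGeometry.Flat (𝓐.subschemeι ≫ σ' ≫ q)) ∧
            (𝓒.comap j = AlgebraicGeometry.Scheme.IdealSheafData.vanishingIdeal (⟨closure C, isClosed_closure⟩ : TopologicalSpace.Closeds F₁) ∧ (∀ z : X', (Literature.AlgebraicGeometry.Resolution.stalkIdeal 𝓒 z).IsPrincipal) ∧ Literature.AlgebraicGeometry.Resolution.Scheme.IsRegular 𝓒.subscheme ∧ σ' '' (𝓒.support : Set X') ⊆ {y : ↥P | ¬ IsGenericPoint y Y} ∧ AlgebraicGeometry.Flat (𝓒.subschemeι ≫ σ' ≫ q)) ∧ 𝓚 ≤ 𝓐 ⊔ 𝓒)) →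
      ∀ (Lt : Option (Set F₁)) (x : ↥(AlgebraicGeometry.Scheme.IdealSheafData.vanishingIdeal (⟨closure T₁, isClosed_closure⟩ : TopologicalSpace.Closeds F₁)).subscheme) (hx : IsClosed ({((AlgebraicGeometry.Scheme.IdealSheafData.vanishingIdeal (⟨closure T₁, isClosed_closure⟩ : TopologicalSpace.Closeds F₁)).subschemeι x : F₁)} : Set F₁)),
        ¬ IsRegularLocalRing ((AlgebraicGeometry.Scheme.IdealSheafData.vanishingIdeal (⟨closure T₁, isClosed_closure⟩ : TopologicalSpace.Closeds F₁)).subscheme.presheaf.stalk x) → IsRegularLocalRing (F₁.presheaf.stalk ((AlgebraicGeometry.Scheme.IdealSheafData.vanishingIdeal (⟨closure T₁, isClosed_closure⟩ : TopologicalSpace.Closeds F₁)).subschemeι x : F₁)) →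
        (∀ L ∈ Ls, ((AlgebraicGeometry.Scheme.IdealSheafData.vanishingIdeal (⟨closure T₁, isClosed_closure⟩ : TopologicalSpace.Closeds F₁)).subschemeι x : F₁) ∈ closure L → Lt = some L) →
        (∀ L : Set F₁, Lt = some L → L ∈ Ls ∧ ∀ e : ↥(redSub F₁ (closure L) isClosed_closure), (redSubι F₁ (closure L) isClosed_closure e : F₁) = ((AlgebraicGeometry.Scheme.IdealSheafData.vanishingIdeal (⟨closure T₁, isClosed_closure⟩ : TopologicalSpace.Closeds F₁)).subschemeι x : F₁) →
          IsRegularLocalRing ((redSub F₁ (closure L) isClosed_closure).presheaf.stalk e)) →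
        (∀ K A C : Set F₁, Kp = some (K, A, C) → ((AlgebraicGeometry.Scheme.IdealSheafData.vanishingIdeal (⟨closure T₁, isClosed_closure⟩ : TopologicalSpace.Closeds F₁)).subschemeι x : F₁) ∉ closure K ∧ ((AlgebraicGeometry.Scheme.IdealSheafData.vanishingIdeal (⟨closure T₁, isClosed_closure⟩ : TopologicalSpace.Closeds F₁)).subschemeι x : F₁) ∉ closure A ∧ ((AlgebraicGeometry.Scheme.IdealSheafData.vanishingIdeal (⟨closure T₁, isClosed_closure⟩ : TopologicalSpace.Closeds F₁)).subschemeι x : F₁) ∉ closure C) →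
      ∀ (F₂ : AlgebraicGeometry.Scheme.{0}) (υ : F₂ ⟶ F₁), Literature.AlgebraicGeometry.Resolution.IsBlowup υ
          (AlgebraicGeometry.Scheme.IdealSheafData.vanishingIdeal (⟨{((AlgebraicGeometry.Scheme.IdealSheafData.vanishingIdeal (⟨closure T₁, isClosed_closure⟩ : TopologicalSpace.Closeds F₁)).subschemeι x : F₁)}, hx⟩ : TopologicalSpace.Closeds F₁)) →
        ∃ (X₉ : AlgebraicGeometry.Scheme.{0}) (σ₉ : X₉ ⟶ P) (S₉ : Set X₉) (j₉ : F₂ ⟶ X₉) (t₉ : F₂ ⟶ AlgebraicGeometry.Spec (.of k)),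
          Ch X₉ σ₉ S₉ ∧ AlgebraicGeometry.IsIntegral X₉ ∧ IsLocallyNoetherian X₉ ∧ Literature.AlgebraicGeometry.Resolution.Scheme.IsRegular X₉ ∧ AlgebraicGeometry.IsDominant (σ₉ ≫ q) ∧
          IsPullback j₉ t₉ (σ₉ ≫ q) (AlgebraicGeometry.Spec.map (CommRingCat.ofHom θ)) ∧ j₉ '' (closure (υ ⁻¹' (T₁ \ {((AlgebraicGeometry.Scheme.IdealSheafData.vanishingIdeal (⟨closure T₁, isClosed_closure⟩ : TopologicalSpace.Closeds F₁)).subschemeι x : F₁)}))) = S₉ ∧ IsClosed (closure (υ ⁻¹' (T₁ \ {((AlgebraicGeometry.Scheme.IdealSheafData.vanishingIdeal (⟨closure T₁, isClosed_closure⟩ : TopologicalSpace.Closeds F₁)).subschemeι x : F₁)}))) ∧ IsIrreducible (closure (υ ⁻¹' (T₁ \ {((AlgebraicGeometry.Scheme.IdealSheafData.vanishingIdeal (⟨closure T₁, isClosed_closure⟩ : TopologicalSpace.Closeds F₁)).subschemeι x : F₁)}))) ∧ AlgebraicGeometry.IsIntegral F₂ ∧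
          (∀ L ∈ Ls, TCPlus.LetterDatum O P q Y F₂ X₉ σ₉ j₉ (closure (υ ⁻¹' (L \ {((AlgebraicGeometry.Scheme.IdealSheafData.vanishingIdeal (⟨closure T₁, isClosed_closure⟩ : TopologicalSpace.Closeds F₁)).subschemeι x : F₁)})))) ∧ TCPlus.LetterDatum O P q Y F₂ X₉ σ₉ j₉ (υ ⁻¹' {((AlgebraicGeometry.Scheme.IdealSheafData.vanishingIdeal (⟨closure T₁, isClosed_closure⟩ : TopologicalSpace.Closeds F₁)).subschemeι x : F₁)}) ∧
          (∀ K A C : Set F₁, Kp = some (K, A, C) → (∃ (𝓚 𝓐 𝓒 : X₉.IdealSheafData), (𝓚.comap j₉ = AlgebraicGeometry.Scheme.IdealSheafData.vanishingIdeal (⟨closure (closure (υ ⁻¹' (K \ {((AlgebraicGeometry.Scheme.IdealSheafData.vanishingIdeal (⟨closure T₁, isClosed_closure⟩ : TopologicalSpace.Closeds F₁)).subschemeι x : F₁)}))), isClosed_closure⟩ : TopologicalSpace.Closeds F₂) ∧ (∀ z : X₉, (Literature.AlgebraicGeometry.Resolution.stalkIdeal 𝓚 z).IsPrincipal) ∧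 Literature.AlgebraicGeometry.Resolution.Scheme.IsRegular 𝓚.subscheme ∧ σ₉ '' (𝓚.support : Set X₉) ⊆ {y : ↥P | ¬ IsGenericPoint y Y} ∧ AlgebraicGeometry.Flat (𝓚.subschemeι ≫ σ₉ ≫ q)) ∧
            (𝓐.comap j₉ = AlgebraicGeometry.Scheme.IdealSheafData.vanishingIdeal (⟨closure (closure (υ ⁻¹' (A \ {((AlgebraicGeometry.Scheme.IdealSheafData.vanishingIdeal (⟨closure T₁, isClosed_closure⟩ : TopologicalSpace.Closeds F₁)).subschemeι x : F₁)}))), isClosed_closure⟩ : TopologicalSpace.Closeds F₂) ∧ (∀ z : X₉, (Literature.AlgebraicGeometry.Resolution.stalkIdeal 𝓐 z).IsPrincipal) ∧ Literature.AlgebraicGeometry.Resolution.Scheme.IsRegular 𝓐.subscheme ∧ σ₉ '' (𝓐.support : Set X₉) ⊆ {y : ↥P | ¬ IsGenericPoint y Y} ∧ AlgebraicGeometry.Flat (𝓐.subschemeι ≫ σ₉ ≫ q)) ∧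
            (𝓒.comap j₉ = AlgebraicGeometry.Scheme.IdealSheafData.vanishingIdeal (⟨closure (closure (υ ⁻¹' (C \ {((AlgebraicGeometry.Scheme.IdealSheafData.vanishingIdeal (⟨closure T₁, isClosed_closure⟩ : TopologicalSpace.Closeds F₁)).subschemeι x : F₁)}))), isClosed_closure⟩ : TopologicalSpace.Closeds F₂) ∧ (∀ z : X₉, (Literature.AlgebraicGeometry.Resolution.stalkIdeal 𝓒 z).IsPrincipal) ∧ Literature.AlgebraicGeometry.Resolution.Scheme.IsRegular 𝓒.subscheme ∧ σ₉ '' (𝓒.support : Set X₉) ⊆ {y : ↥P | ¬ IsGenericPoint y Y} ∧ AlgebraicGeometry.Flat (𝓒.subschemeι ≫ σ₉ ≫ q)) ∧ 𝓚 ≤ 𝓐 ⊔ 𝓒)) := by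
  intro O _ _ _ _ _ θ hθ P q Y Ch hChStep hChSplit hYsp hYirr hYcl hPint hPnoeth hPreg hqprop hqsm X' σ' S' hCh' hX'int hX'noeth hX'reg hX'dom
    F₁ hF₁ j t hsq T₁ hT₁cl hT₁irr hjT₁ Ls Kp hLs hTag Lt x hx hxreg hFreg hLt hLt' hKaway F₂ υ hυ
  classical
  haveI := hPint; haveI := hPnoeth; haveI := hX'int; haveI := hX'noeth; haveI := hF₁; haveI := hqprop; haveI := hqsm
  haveI : IsClosedImmersion (Spec.map (CommRingCat.ofHom θ)) := IsClosedImmersion.spec_of_surjective _ hθ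
  haveI hjci : IsClosedImmersion j := MorphismProperty.IsStableUnderBaseChange.of_isPullback hsq.flip inferInstance
  haveI : IsLocallyNoetherian F₁ := LocallyOfFiniteType.isLocallyNoetherian j
  have hch : Chain P Y X' σ' S' := hChSplit _ _ _ hCh'
  obtain ⟨-, -, hσ'prop⟩ := chain_isRegular P Y X' σ' S' hch hPnoeth hPreg
  haveI := hσ'prop
  haveI : IsProper (σ' ≫ q) := inferInstance
  -- THE ONE HOST of the point step: the through-letter if there is one, the EMPTY letter otherwise
  obtain ⟨E₁, hLE₁, hEreg, hothers⟩ : ∃ E₁ : Set F₁, TCPlus.LetterDatum O P q Y F₁ X' σ' j E₁ ∧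
      (((AlgebraicGeometry.Scheme.IdealSheafData.vanishingIdeal (⟨closure T₁, isClosed_closure⟩ : TopologicalSpace.Closeds F₁)).subschemeι x : F₁) ∈ closure E₁ → ∀ e : ↥(redSub F₁ (closure E₁) isClosed_closure), (redSubι F₁ (closure E₁) isClosed_closure e : F₁) = ((AlgebraicGeometry.Scheme.IdealSheafData.vanishingIdeal (⟨closure T₁, isClosed_closure⟩ : TopologicalSpace.Closeds F₁)).subschemeι x : F₁) →
        IsRegularLocalRing ((redSub F₁ (closure E₁) isClosed_closure).presheaf.stalk e)) ∧
      ∀ L ∈ Ls, L = E₁ ∨ ((AlgebraicGeometry.Scheme.IdealSheafData.vanishingIdeal (⟨closure T₁, isClosed_closure⟩ : TopologicalSpace.Closeds F₁)).subschemeι x : F₁) ∉ closure L := by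
    cases hLt0 : Lt with
    | none =>
      refine ⟨∅, TCPlus.letterDatum_empty O P q Y F₁ X' σ' j, fun h => ?_, fun L hL => Or.inr fun hxL => ?_⟩
      · rw [closure_empty] at h; exact h.elim
      · have := hLt L hL hxL; rw [hLt0] at this; exact Option.some_ne_none L this.symm
    | some L₀ =>
      obtain ⟨hL₀, hreg⟩ := hLt' L₀ (by rw [hLt0])
      refine ⟨L₀, hLs L₀ hL₀, fun _ => hreg, fun L hL => ?_⟩
      by_cases hxL : ((AlgebraicGeometry.Scheme.IdealSheafData.vanishingIdeal (⟨closure T₁, isClosed_closure⟩ : TopologicalSpace.Closeds F₁)).subschemeι x : F₁) ∈ closure L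
      · have := hLt L hL hxL; rw [hLt0] at this; exact Or.inl (Option.some.inj this).symm
      · exact Or.inr hxL
  -- THE POINT STEP WITH THE HOST (✓ `TCPlus.hpt_seam`)
  obtain ⟨hF₂, hT₂irr, U, s, X₁, τ₁, j₂, t₂, hU, hs, hsU, hsx, hsoff, hτ₁, hcomm, hexc, hCh₁, hint₁, hnoeth₁, hreg₁, hdom₁, hsq₂, hLE⟩ :=
    TCPlus.hpt_seam k n O θ hθ P q Y Ch hChStep hChSplit hYsp hYirr hYcl hPint hPnoeth hPreg hqprop hqsm X' σ' S' hCh' hX'int hX'noeth hX'reg hX'dom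
      F₁ hF₁ j t hsq T₁ hT₁cl hT₁irr hjT₁ E₁ hLE₁ x hx hxreg hFreg hEreg F₂ υ hυ
  haveI := hint₁; haveI := hnoeth₁; haveI := hF₂
  -- the section's kernel: support `= range s`, disjoint from every ideal sheaf missing `j x`
  obtain ⟨_, -, -, hCsupp⟩ := section_isClosedImmersion_and_isRegular_ker O X' (σ' ≫ q) s hs
  have hdisj : ∀ I : X'.IdealSheafData, j ((AlgebraicGeometry.Scheme.IdealSheafData.vanishingIdeal (⟨closure T₁, isClosed_closure⟩ : TopologicalSpace.Closeds F₁)).subschemeι x : F₁) ∉ (I.support : Set X') → Disjoint (I.support : Set X') (s.ker.support : Set X') :=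
    fun I hI => disjoint_support_ker_section O (σ' ≫ q) s hs I (by rw [hsx]; exact hI)
  -- every OTHER listed letter is AWAY and keeps its model
  have hLs₂ : ∀ L ∈ Ls, TCPlus.LetterDatum O P q Y F₂ X₁ (τ₁ ≫ σ') j₂ (closure (υ ⁻¹' (L \ {((AlgebraicGeometry.Scheme.IdealSheafData.vanishingIdeal (⟨closure T₁, isClosed_closure⟩ : TopologicalSpace.Closeds F₁)).subschemeι x : F₁)}))) := by
    intro L hL
    rcases hothers L hL with rfl | hxL
    · exact hLE
    · obtain ⟨𝓛, hl1, hl2, hl3, hl4, hl5⟩ := hLs L hL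
      exact ⟨𝓛.comap τ₁, TCPlus.letterClauses_transport_away O P q Y hτ₁ hx hυ hcomm hdisj 𝓛 hl1 hl2 hl3 hl4 hl5 hxL⟩
  -- the NEW exceptional letter (✓ `TCPlus.letterDatum_newPlane`)
  have hw : ¬ IsGenericPoint (σ' (j ((AlgebraicGeometry.Scheme.IdealSheafData.vanishingIdeal (⟨closure T₁, isClosed_closure⟩ : TopologicalSpace.Closeds F₁)).subschemeι x : F₁))) Y := by
    have h1 := hsoff (s (closedPoint O)) (by rw [hCsupp]; exact ⟨_, rfl⟩)
    rwa [hsx] at h1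
  have hE₂ : TCPlus.LetterDatum O P q Y F₂ X₁ (τ₁ ≫ σ') j₂ (υ ⁻¹' {((AlgebraicGeometry.Scheme.IdealSheafData.vanishingIdeal (⟨closure T₁, isClosed_closure⟩ : TopologicalSpace.Closeds F₁)).subschemeι x : F₁)}) :=
    TCPlus.letterDatum_newPlane O hθ P q Y hYsp hX'reg hsq hs hx hsx hw hFreg hτ₁ hυ hcomm
  -- the TAG block: its three letters are AWAY; the incidence is transported by `comap`
  refine ⟨X₁, τ₁ ≫ σ', _, j₂, t₂, hCh₁, hint₁, hnoeth₁, hreg₁, hdom₁, hsq₂, rfl, isClosed_closure, hT₂irr, hF₂, hLs₂, hE₂, ?_⟩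
  intro K A C hKp
  obtain ⟨𝓚, 𝓐, 𝓒, ⟨hK1, hK2, hK3, hK4, hK5⟩, ⟨hA1, hA2, hA3, hA4, hA5⟩, ⟨hC1, hC2, hC3, hC4, hC5⟩, hinc⟩ := hTag K A C hKp
  obtain ⟨hxK, hxA, hxC⟩ := hKaway K A C hKp
  refine ⟨𝓚.comap τ₁, 𝓐.comap τ₁, 𝓒.comap τ₁,
    TCPlus.letterClauses_transport_away O P q Y hτ₁ hx hυ hcomm hdisj 𝓚 hK1 hK2 hK3 hK4 hK5 hxK,
    TCPlus.letterClauses_transport_away O P q Y hτ₁ hx hυ hcomm hdisj 𝓐 hA1 hA2 hA3 hA4 hA5 hxA,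
    TCPlus.letterClauses_transport_away O P q Y hτ₁ hx hυ hcomm hdisj 𝓒 hC1 hC2 hC3 hC4 hC5 hxC, ?_⟩
  rw [← Scheme.IdealSheafData.comap_sup]
  exact Scheme.IdealSheafData.comap_mono τ₁ hinc

end Summit.ResolutionOfSingularities.ResolutionOfSingularities.Cruxes.EquisingularLiftNat.Sections

end
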